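import Literature.NumberTheory.Sieve.LinearEquationsInPrimesHeisenbergBoxMetric
import HarnessLib

/-!
# Route `GreenTaoLevelTwo`, crux `GITwo` (stmt-Parity-21275), line `birth`: lemmas for the BC5
# rung `stub_rung_quadraticPhase` — the test function, its Lipschitz estimate, the orbit, the sum

Helper file (§1–§4) for `GreenTaoLevelTwoGITwoQuadraticPhaseRung.lean`, which proves the
registered BC5 rung of the `GITwo` birth skeleton: for EVERY Def-8.1 metric `d` on
`H³(ℝ)/H³(ℤ)` that is box-comparable (`IsBoxComparable d`, constant `L`), there are `M, c`
(here `M = 8πL`, `c = ½`) such that every quadratic phase `e(αn² + βn)` on `[N]` correlates `≥ c`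
with a `1`-bounded `M`-Lipschitz nilsequence `F(gⁿ x₀)` on the re-metrised Heisenberg nilmanifold
`heisenbergWith d h` — uniformly in `N ≥ 1`, `α`, `β`.  This is the "construct" half of Green–Tao's
conversion of quadratic phases into Heisenberg nilsequences (the proof of Thm. 12.8 / Prop. 12.9 of
the `U³` inverse paper), carried out with explicit constants.

Construction (all explicit, no new definitions):
* the test function on `H³(ℝ)` is `Φ(x, y, z) = cos(2π(z − x⌊y⌋)) · sin²(πy)`; it is invariant
  under RIGHT multiplication by `Γ = H³(ℤ)` (`z − x⌊y⌋` moves by an integer, `sin²(πy)` is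
  `1`-periodic), so `F(p) = Φ(out p)` is a function on `G/Γ` with `F(gΓ) = Φ(g)`;
* `|Φ| ≤ 1` and `|Φ(g) − Φ(h)| ≤ 8π · S(g h⁻¹)` for the box gauge `S` (§1: if `⌊y_g⌋ = ⌊y_h⌋` the
  phase moves by `≤ 2S` and `sin²` by `≤ 2πS`; otherwise both `sin²` factors are `≤ πS`), whence
  `|F(p) − F(q)| ≤ 8π ρ₀(p, q) ≤ 8πL · d(p, q)`;
* with `g = (−2α, 1, β)` and `x₀ = (0, ½, z₀)Γ` the orbit has `y = n + ½` and
  `z − x⌊y⌋ = αn² + βn + z₀`, so `F(gⁿ x₀) = cos(2π(αn² + βn + z₀))`;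
* `∑ e(θₙ) cos(2π(θₙ + z₀)) = (e(z₀) T + N e(−z₀))/2` with `T = ∑ e(2θₙ)`; since
  `‖T + N‖ + ‖N − T‖ ≥ 2N`, one of `z₀ = 0` (`‖T + N‖/2`) or `z₀ = ¼` (`‖N − T‖/2`) gives `≥ N/2`.

References: B. Green, T. Tao, *An inverse theorem for the Gowers U³(G) norm*, Proc. Edinb. Math.
Soc. 51 (2008) 73–153, §12 (quadratic phases as Heisenberg nilsequences; the cube coordinates and
the `2π`-Lipschitz test functions) [GreenTao2008U3Inverse]; B. Green, T. Tao, *Linear equations in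
primes*, Ann. of Math. 171 (2010), §8 (the Heisenberg example) [GreenTao2010].
-/

noncomputable section

open Literature.NumberTheory.Sieve
open Literature.NumberTheory.Sieve.GreenTaoLevelTwo

namespace Summit.Parity.GeneralizedHardyLittlewood.GreenTaoLevelTwoGITwoQuadraticPhaseRung

/-! ### §1 The test function `Φ(x,y,z) = cos(2π(z − x⌊y⌋)) · sin²(πy)` on `H³(ℝ)` -/

/-- Under right multiplication by a lattice element the phase `z − x⌊y⌋` moves by an integer.
[cite: GreenTao2008U3Inverse, §12] -/
theorem phase_mul_lattice (g γ : Heis) (hγ : γ ∈ Heis.latticeΓ) :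
    ∃ k : ℤ, (g * γ).z - (g * γ).x * ⌊(g * γ).y⌋ = (g.z - g.x * ⌊g.y⌋) + k := by
  obtain ⟨⟨a, ha⟩, ⟨b, hb⟩, ⟨c, hc⟩⟩ := hγ
  refine ⟨c - a * ⌊g.y⌋ - a * b, ?_⟩
  rw [Heis.z_mul, Heis.x_mul, Heis.y_mul, ha, hb, hc, Int.floor_add_intCast]
  push_cast
  ring

/-- `Φ` is invariant under right multiplication by `Γ = H³(ℤ)`.
[cite: GreenTao2008U3Inverse, §12] -/
theorem phi_mul_lattice (g γ : Heis) (hγ : γ ∈ Heis.latticeΓ) :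
    Real.cos (2 * Real.pi * ((g * γ).z - (g * γ).x * ⌊(g * γ).y⌋)) *
        Real.sin (Real.pi * (g * γ).y) ^ 2 =
      Real.cos (2 * Real.pi * (g.z - g.x * ⌊g.y⌋)) * Real.sin (Real.pi * g.y) ^ 2 := by
  obtain ⟨k, hk⟩ := phase_mul_lattice g γ hγ
  obtain ⟨_, ⟨b, hb⟩, _⟩ := hγ
  rw [hk, Heis.y_mul, hb]
  congr 1
  · rw [mul_add, mul_comm (2 * Real.pi) (k : ℝ), Real.cos_add_int_mul_two_pi]
  · rw [Real.sin_sq_eq_half_sub, Real.sin_sq_eq_half_sub]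
    have : 2 * (Real.pi * (g.y + (b : ℝ))) = 2 * (Real.pi * g.y) + b * (2 * Real.pi) := by ring
    rw [this, Real.cos_add_int_mul_two_pi]

/-- `|Φ| ≤ 1`. [cite: GreenTao2008U3Inverse, §12] -/
theorem abs_phi_le_one (u : Heis) :
    |Real.cos (2 * Real.pi * (u.z - u.x * ⌊u.y⌋)) * Real.sin (Real.pi * u.y) ^ 2| ≤ 1 := by
  rw [abs_mul, abs_of_nonneg (sq_nonneg (Real.sin (Real.pi * u.y)))]
  calc |Real.cos (2 * Real.pi * (u.z - u.x * ⌊u.y⌋))| * Real.sin (Real.pi * u.y) ^ 2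
      ≤ 1 * 1 := mul_le_mul (Real.abs_cos_le_one _) (Real.sin_sq_le_one _) (sq_nonneg _)
          zero_le_one
    _ = 1 := one_mul 1

/-- `sin²(πt) ≤ π |t − m|` for every integer `m`. [folklore] -/
theorem sin_sq_le_pi_mul_abs_sub_int (t : ℝ) (m : ℤ) :
    Real.sin (Real.pi * t) ^ 2 ≤ Real.pi * |t - m| := by
  have h1 : |Real.sin (Real.pi * t)| ≤ Real.pi * |t - m| := by
    have e : Real.pi * t = Real.pi * (t - m) + m * Real.pi := by ring
    rw [e, Real.sin_add_int_mul_pi, abs_mul, abs_neg_one_zpow, one_mul]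
    calc |Real.sin (Real.pi * (t - m))| ≤ |Real.pi * (t - m)| := Real.abs_sin_le_abs
      _ = Real.pi * |t - m| := by rw [abs_mul, abs_of_pos Real.pi_pos]
  have h2 : Real.sin (Real.pi * t) ^ 2 ≤ |Real.sin (Real.pi * t)| := by
    rw [← sq_abs]
    have h3 : |Real.sin (Real.pi * t)| ≤ 1 := Real.abs_sin_le_one _
    nlinarith [abs_nonneg (Real.sin (Real.pi * t))]
  exact h2.trans h1

/-- If `⌊s⌋ ≠ ⌊t⌋` there is an integer within `|s − t|` of both `s` and `t`. [folklore] -/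
theorem exists_int_near_of_floor_ne {s t : ℝ} (h : ⌊s⌋ ≠ ⌊t⌋) :
    ∃ m : ℤ, |s - m| ≤ |s - t| ∧ |t - m| ≤ |s - t| := by
  rcases lt_or_gt_of_ne h with hlt | hlt
  · -- `⌊s⌋ < ⌊t⌋`: take `m = ⌊t⌋`, so `s < m ≤ t`
    refine ⟨⌊t⌋, ?_, ?_⟩
    · have h1 : s < (⌊t⌋ : ℝ) := by
        have h2 : (⌊s⌋ : ℝ) + 1 ≤ (⌊t⌋ : ℝ) := by exact_mod_cast Int.add_one_le_iff.mpr hlt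
        linarith [Int.lt_floor_add_one s]
      have h3 := Int.floor_le t
      rw [abs_of_neg (by linarith), abs_of_neg (by linarith)]
      linarith
    · have h1 : s < (⌊t⌋ : ℝ) := by
        have h2 : (⌊s⌋ : ℝ) + 1 ≤ (⌊t⌋ : ℝ) := by exact_mod_cast Int.add_one_le_iff.mpr hlt
        linarith [Int.lt_floor_add_one s]
      have h3 := Int.floor_le t
      rw [abs_of_nonneg (by linarith), abs_of_neg (by linarith)]
      linarith
  · -- `⌊t⌋ < ⌊s⌋`: take `m = ⌊s⌋`, so `t < m ≤ s`
    refine ⟨⌊s⌋, ?_, ?_⟩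
    · have h1 : t < (⌊s⌋ : ℝ) := by
        have h2 : (⌊t⌋ : ℝ) + 1 ≤ (⌊s⌋ : ℝ) := by exact_mod_cast Int.add_one_le_iff.mpr hlt
        linarith [Int.lt_floor_add_one t]
      have h3 := Int.floor_le s
      rw [abs_of_nonneg (by linarith), abs_of_pos (by linarith)]
      linarith
    · have h1 : t < (⌊s⌋ : ℝ) := by
        have h2 : (⌊t⌋ : ℝ) + 1 ≤ (⌊s⌋ : ℝ) := by exact_mod_cast Int.add_one_le_iff.mpr hlt
        linarith [Int.lt_floor_add_one t]
      have h3 := Int.floor_le s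
      rw [abs_of_neg (by linarith), abs_of_pos (by linarith)]
      linarith

/-- **The Lipschitz estimate for `Φ` in the cube coordinates**: `|Φ(g) − Φ(h)| ≤ 8π · S(g h⁻¹)`
for the box gauge `S` ("all of the functions F used in these constructions are 2π-Lipschitz").
[cite: GreenTao2008U3Inverse, §12] -/
theorem abs_phi_sub_phi_le (g h : Heis) :
    |Real.cos (2 * Real.pi * (g.z - g.x * ⌊g.y⌋)) * Real.sin (Real.pi * g.y) ^ 2 -
        Real.cos (2 * Real.pi * (h.z - h.x * ⌊h.y⌋)) * Real.sin (Real.pi * h.y) ^ 2| ≤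
      8 * Real.pi * boxGauge (g * h⁻¹) := by
  set S := boxGauge (g * h⁻¹) with hS
  have hS0 : 0 ≤ S := boxGauge_nonneg _
  have hπ := Real.pi_pos
  -- the coordinates of `u = g h⁻¹`
  have ha : |g.x - h.x| ≤ S := by
    have := abs_x_le_boxGauge (g * h⁻¹)
    rwa [Heis.x_mul, Heis.x_inv, ← sub_eq_add_neg] at this
  have hb : |g.y - h.y| ≤ S := by
    have := abs_y_le_boxGauge (g * h⁻¹)
    rwa [Heis.y_mul, Heis.y_inv, ← sub_eq_add_neg] at this
  have hc : |g.z - h.z - (g.x - h.x) * h.y| ≤ S := by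
    have := abs_z_le_boxGauge (g * h⁻¹)
    rw [Heis.z_mul, Heis.z_inv, Heis.y_inv] at this
    have e : g.z + (-h.z + h.x * h.y) + g.x * -h.y = g.z - h.z - (g.x - h.x) * h.y := by ring
    rwa [e] at this
  by_cases hk : ⌊g.y⌋ = ⌊h.y⌋
  · -- same integer part: the phase moves by `≤ 2S`, the cutoff by `≤ 2πS`
    rw [hk]
    set k : ℤ := ⌊h.y⌋ with hkdef
    have hfl0 : (k : ℝ) ≤ h.y := Int.floor_le h.y
    have hfl1 : h.y < (k : ℝ) + 1 := Int.lt_floor_add_one h.y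
    have hΔ : |(g.z - g.x * k) - (h.z - h.x * k)| ≤ 2 * S := by
      have e : (g.z - g.x * k) - (h.z - h.x * k) =
          (g.z - h.z - (g.x - h.x) * h.y) + (g.x - h.x) * (h.y - k) := by ring
      rw [e]
      calc |(g.z - h.z - (g.x - h.x) * h.y) + (g.x - h.x) * (h.y - k)|
          ≤ |g.z - h.z - (g.x - h.x) * h.y| + |(g.x - h.x) * (h.y - k)| := abs_add_le _ _
        _ ≤ S + S * 1 := by
            rw [abs_mul]
            refine add_le_add hc (mul_le_mul ha ?_ (abs_nonneg _) hS0)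
            rw [abs_le]; constructor <;> linarith
        _ = 2 * S := by ring
    have hcos : |Real.cos (2 * Real.pi * (g.z - g.x * k)) - Real.cos (2 * Real.pi * (h.z - h.x * k))|
        ≤ 4 * Real.pi * S := by
      calc _ ≤ |2 * Real.pi * (g.z - g.x * k) - 2 * Real.pi * (h.z - h.x * k)| :=
            Real.abs_cos_sub_cos_le _ _
        _ = 2 * Real.pi * |(g.z - g.x * k) - (h.z - h.x * k)| := by
            rw [← mul_sub, abs_mul, abs_of_pos (by positivity)]
        _ ≤ 2 * Real.pi * (2 * S) := mul_le_mul_of_nonneg_left hΔ (by positivity)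
        _ = 4 * Real.pi * S := by ring
    have hsin : |Real.sin (Real.pi * g.y) ^ 2 - Real.sin (Real.pi * h.y) ^ 2| ≤ 2 * Real.pi * S := by
      rw [sq_sub_sq, abs_mul]
      calc |Real.sin (Real.pi * g.y) + Real.sin (Real.pi * h.y)| *
            |Real.sin (Real.pi * g.y) - Real.sin (Real.pi * h.y)|
          ≤ 2 * (Real.pi * S) := by
            refine mul_le_mul ?_ ?_ (abs_nonneg _) (by norm_num)
            · calc _ ≤ |Real.sin (Real.pi * g.y)| + |Real.sin (Real.pi * h.y)| := abs_add_le _ _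
                _ ≤ 1 + 1 := add_le_add (Real.abs_sin_le_one _) (Real.abs_sin_le_one _)
                _ = 2 := by norm_num
            · calc _ ≤ |Real.pi * g.y - Real.pi * h.y| := Real.abs_sin_sub_sin_le _ _
                _ = Real.pi * |g.y - h.y| := by rw [← mul_sub, abs_mul, abs_of_pos hπ]
                _ ≤ Real.pi * S := mul_le_mul_of_nonneg_left hb hπ.le
        _ = 2 * Real.pi * S := by ring
    -- `|AB − A'B'| ≤ |A − A'| B + |A'| |B − B'|`
    have hB : 0 ≤ Real.sin (Real.pi * g.y) ^ 2 := sq_nonneg _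
    have hB1 : Real.sin (Real.pi * g.y) ^ 2 ≤ 1 := Real.sin_sq_le_one _
    have hA' : |Real.cos (2 * Real.pi * (h.z - h.x * k))| ≤ 1 := Real.abs_cos_le_one _
    have e : Real.cos (2 * Real.pi * (g.z - g.x * k)) * Real.sin (Real.pi * g.y) ^ 2 -
        Real.cos (2 * Real.pi * (h.z - h.x * k)) * Real.sin (Real.pi * h.y) ^ 2 =
        (Real.cos (2 * Real.pi * (g.z - g.x * k)) - Real.cos (2 * Real.pi * (h.z - h.x * k))) *
            Real.sin (Real.pi * g.y) ^ 2 +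
          Real.cos (2 * Real.pi * (h.z - h.x * k)) *
            (Real.sin (Real.pi * g.y) ^ 2 - Real.sin (Real.pi * h.y) ^ 2) := by ring
    rw [e]
    calc _ ≤ |(Real.cos (2 * Real.pi * (g.z - g.x * k)) - Real.cos (2 * Real.pi * (h.z - h.x * k))) *
              Real.sin (Real.pi * g.y) ^ 2| +
            |Real.cos (2 * Real.pi * (h.z - h.x * k)) *
              (Real.sin (Real.pi * g.y) ^ 2 - Real.sin (Real.pi * h.y) ^ 2)| := abs_add_le _ _
      _ ≤ 4 * Real.pi * S * 1 + 1 * (2 * Real.pi * S) := by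
          rw [abs_mul, abs_mul, abs_of_nonneg hB]
          exact add_le_add (mul_le_mul hcos hB1 hB (mul_nonneg (by positivity) hS0))
            (mul_le_mul hA' hsin (abs_nonneg _) zero_le_one)
      _ ≤ 8 * Real.pi * S := by nlinarith [hS0, hπ]
  · -- different integer parts: both cutoffs are `≤ πS`
    obtain ⟨m, hgm, hhm⟩ := exists_int_near_of_floor_ne hk
    have h1 : Real.sin (Real.pi * g.y) ^ 2 ≤ Real.pi * S :=
      (sin_sq_le_pi_mul_abs_sub_int g.y m).trans
        (mul_le_mul_of_nonneg_left (hgm.trans hb) hπ.le)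
    have h2 : Real.sin (Real.pi * h.y) ^ 2 ≤ Real.pi * S :=
      (sin_sq_le_pi_mul_abs_sub_int h.y m).trans
        (mul_le_mul_of_nonneg_left (hhm.trans hb) hπ.le)
    have hg1 : |Real.cos (2 * Real.pi * (g.z - g.x * ⌊g.y⌋)) * Real.sin (Real.pi * g.y) ^ 2| ≤
        Real.pi * S := by
      rw [abs_mul, abs_of_nonneg (sq_nonneg (Real.sin (Real.pi * g.y)))]
      calc _ ≤ 1 * (Real.pi * S) :=
            mul_le_mul (Real.abs_cos_le_one _) h1 (sq_nonneg _) zero_le_one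
        _ = Real.pi * S := one_mul _
    have hh1 : |Real.cos (2 * Real.pi * (h.z - h.x * ⌊h.y⌋)) * Real.sin (Real.pi * h.y) ^ 2| ≤
        Real.pi * S := by
      rw [abs_mul, abs_of_nonneg (sq_nonneg (Real.sin (Real.pi * h.y)))]
      calc _ ≤ 1 * (Real.pi * S) :=
            mul_le_mul (Real.abs_cos_le_one _) h2 (sq_nonneg _) zero_le_one
        _ = Real.pi * S := one_mul _
    calc _ ≤ |Real.cos (2 * Real.pi * (g.z - g.x * ⌊g.y⌋)) * Real.sin (Real.pi * g.y) ^ 2| +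
          |Real.cos (2 * Real.pi * (h.z - h.x * ⌊h.y⌋)) * Real.sin (Real.pi * h.y) ^ 2| :=
          abs_sub _ _
      _ ≤ Real.pi * S + Real.pi * S := add_le_add hg1 hh1
      _ ≤ 8 * Real.pi * S := by nlinarith [hS0, hπ]

/-! ### §2 The function `F(gΓ) = Φ(g)` on `H³(ℝ)/H³(ℤ)`: well defined, bounded, Lipschitz -/

/-- `F(gΓ) = Φ(g)`: the value at a coset does not depend on the representative `out`.
[cite: GreenTao2008U3Inverse, §12] -/
theorem phi_out_mk (g : Heis) :
    Real.cos (2 * Real.pi * ((Quotient.out (g : HX) : Heis).z -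
        (Quotient.out (g : HX) : Heis).x * ⌊(Quotient.out (g : HX) : Heis).y⌋)) *
        Real.sin (Real.pi * (Quotient.out (g : HX) : Heis).y) ^ 2 =
      Real.cos (2 * Real.pi * (g.z - g.x * ⌊g.y⌋)) * Real.sin (Real.pi * g.y) ^ 2 := by
  obtain ⟨γ, hγ⟩ := QuotientGroup.mk_out_eq_mul Heis.latticeΓ g
  rw [hγ]
  exact phi_mul_lattice g γ γ.2

/-- **`F` is `8π`-Lipschitz for the box pre-distance `ρ₀`** (an infimum over `Γ` of gauges of
`out(p) γ out(q)⁻¹`, each of which controls `|Φ(out p · γ) − Φ(out q)| = |F p − F q|`).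
[cite: GreenTao2008U3Inverse, §12] [cite: GreenTao2012Nilmanifolds, Def. 2.2] -/
theorem abs_F_sub_F_le_heisPreDist (p q : HX) :
    |Real.cos (2 * Real.pi * ((Quotient.out p : Heis).z -
        (Quotient.out p : Heis).x * ⌊(Quotient.out p : Heis).y⌋)) *
        Real.sin (Real.pi * (Quotient.out p : Heis).y) ^ 2 -
      Real.cos (2 * Real.pi * ((Quotient.out q : Heis).z -
        (Quotient.out q : Heis).x * ⌊(Quotient.out q : Heis).y⌋)) *
        Real.sin (Real.pi * (Quotient.out q : Heis).y) ^ 2| ≤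
      8 * Real.pi * heisPreDist p q := by
  have h8 : (0 : ℝ) < 8 * Real.pi := by positivity
  rw [← div_le_iff₀' h8]
  unfold heisPreDist
  refine le_ciInf fun γ => ?_
  rw [div_le_iff₀' h8]
  have h := abs_phi_sub_phi_le (Quotient.out p * (γ : Heis)) (Quotient.out q)
  rwa [phi_mul_lattice (Quotient.out p) γ γ.2] at h

/-! ### §3 The orbit: `g = (−2α, 1, β)`, `x₀ = (0, ½, z₀)`, `F(gⁿx₀) = cos(2π(αn² + βn + z₀))` -/

/-- Coordinates along the orbit and the value of `Φ` there: with `y`-step `1` the floor term is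
itself quadratic, `z − x⌊y⌋ = αn² + βn + z₀`, and the cutoff `sin²(π(n + ½)) = 1`.
[cite: GreenTao2010, §11, Example after Prop. 11.5] [cite: GreenTao2008U3Inverse, §12] -/
theorem phi_orbit (α β z₀ : ℝ) (m : ℕ) :
    Real.cos (2 * Real.pi * (((Heis.mk (-2 * α) 1 β) ^ m * Heis.mk 0 (1 / 2) z₀).z -
        ((Heis.mk (-2 * α) 1 β) ^ m * Heis.mk 0 (1 / 2) z₀).x *
          ⌊((Heis.mk (-2 * α) 1 β) ^ m * Heis.mk 0 (1 / 2) z₀).y⌋)) *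
        Real.sin (Real.pi * ((Heis.mk (-2 * α) 1 β) ^ m * Heis.mk 0 (1 / 2) z₀).y) ^ 2 =
      Real.cos (2 * Real.pi * (α * (m : ℝ) ^ 2 + β * m + z₀)) := by
  obtain ⟨hx, hy, hz⟩ := heis_pow (Heis.mk (-2 * α) 1 β) m
  rw [Heis.z_mul, Heis.x_mul, Heis.y_mul, hx, hy, hz]
  simp only [Heis.x_mk, Heis.y_mk, Heis.z_mk, mul_one, add_zero]
  have hfl : ⌊(m : ℝ) + 1 / 2⌋ = (m : ℤ) := by
    rw [Int.floor_eq_iff]; push_cast; constructor <;> linarith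
  rw [hfl]
  have hsin : Real.sin (Real.pi * ((m : ℝ) + 1 / 2)) ^ 2 = 1 := by
    rw [Real.sin_sq_eq_half_sub]
    have e : 2 * (Real.pi * ((m : ℝ) + 1 / 2)) = m * (2 * Real.pi) + Real.pi := by ring
    rw [e, Real.cos_nat_mul_two_pi_add_pi]; norm_num
  rw [hsin, mul_one]
  congr 1
  push_cast
  ring

/-- The nilsequence read on the quotient: `F(gⁿ x₀) = cos(2π(αn² + βn + z₀))` for `n ≥ 0`.
[cite: GreenTao2008U3Inverse, §12] -/
theorem F_orbit (α β z₀ : ℝ) (n : ℤ) (hn : 0 ≤ n) :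
    Real.cos (2 * Real.pi *
        ((Quotient.out ((Heis.mk (-2 * α) 1 β) ^ n • ((Heis.mk 0 (1 / 2) z₀ : Heis) : HX)) : Heis).z -
          (Quotient.out ((Heis.mk (-2 * α) 1 β) ^ n • ((Heis.mk 0 (1 / 2) z₀ : Heis) : HX)) : Heis).x *
            ⌊(Quotient.out ((Heis.mk (-2 * α) 1 β) ^ n •
              ((Heis.mk 0 (1 / 2) z₀ : Heis) : HX)) : Heis).y⌋)) *
        Real.sin (Real.pi * (Quotient.out ((Heis.mk (-2 * α) 1 β) ^ n •
          ((Heis.mk 0 (1 / 2) z₀ : Heis) : HX)) : Heis).y) ^ 2 =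
      Real.cos (2 * Real.pi * (α * (n : ℝ) ^ 2 + β * n + z₀)) := by
  obtain ⟨m, rfl⟩ := Int.eq_ofNat_of_zero_le hn
  rw [zpow_natCast, MulAction.Quotient.smul_coe, smul_eq_mul, phi_out_mk, phi_orbit]
  simp only [Int.cast_natCast]

/-! ### §4 The exponential sum `∑ e(θₙ) cos(2π(θₙ + z₀))` -/

/-- `e(θ) cos(2π(θ + z₀)) = (e(2θ + z₀) + e(−z₀))/2`. [folklore] -/
theorem exp_mul_cos (θ z₀ : ℝ) :
    Complex.exp (2 * Real.pi * Complex.I * (θ : ℂ)) *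
        ((Real.cos (2 * Real.pi * (θ + z₀)) : ℝ) : ℂ) =
      (Complex.exp (2 * Real.pi * Complex.I * (z₀ : ℂ)) *
          Complex.exp (2 * Real.pi * Complex.I * ((2 * θ : ℝ) : ℂ)) +
        Complex.exp (-(2 * Real.pi * Complex.I * (z₀ : ℂ)))) / 2 := by
  rw [Complex.ofReal_cos]
  have h2 : Complex.cos ((2 * Real.pi * (θ + z₀) : ℝ) : ℂ) =
      (Complex.exp (((2 * Real.pi * (θ + z₀) : ℝ) : ℂ) * Complex.I) +
        Complex.exp (-((2 * Real.pi * (θ + z₀) : ℝ) : ℂ) * Complex.I)) / 2 := by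
    rw [← Complex.two_cos]; ring
  rw [h2, mul_div_assoc', mul_add, ← Complex.exp_add, ← Complex.exp_add, ← Complex.exp_add]
  congr 3
  · push_cast; ring
  · push_cast; ring

/-- `∑ₙ e(θₙ) cos(2π(θₙ + z₀)) = (e(z₀) ∑ₙ e(2θₙ) + #s · e(−z₀))/2`. [folklore] -/
theorem sum_exp_mul_cos (s : Finset ℤ) (θ : ℤ → ℝ) (z₀ : ℝ) :
    ∑ n ∈ s, Complex.exp (2 * Real.pi * Complex.I * (θ n : ℂ)) *
        ((Real.cos (2 * Real.pi * (θ n + z₀)) : ℝ) : ℂ) =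
      (Complex.exp (2 * Real.pi * Complex.I * (z₀ : ℂ)) *
          ∑ n ∈ s, Complex.exp (2 * Real.pi * Complex.I * ((2 * θ n : ℝ) : ℂ)) +
        (s.card : ℂ) * Complex.exp (-(2 * Real.pi * Complex.I * (z₀ : ℂ)))) / 2 := by
  simp_rw [exp_mul_cos]
  rw [← Finset.sum_div, Finset.sum_add_distrib, ← Finset.mul_sum, Finset.sum_const, nsmul_eq_mul]

/-- The dichotomy `‖T + N‖ ≥ N` or `‖N − T‖ ≥ N` (their sum is at least `‖2N‖`). [folklore] -/
theorem norm_dichotomy (T : ℂ) (N : ℕ) :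
    (N : ℝ) ≤ ‖T + (N : ℂ)‖ ∨ (N : ℝ) ≤ ‖(N : ℂ) - T‖ := by
  by_contra hcon
  push Not at hcon
  have h := norm_add_le (T + (N : ℂ)) ((N : ℂ) - T)
  have e : T + (N : ℂ) + ((N : ℂ) - T) = ((2 * N : ℕ) : ℂ) := by push_cast; ring
  rw [e, Complex.norm_natCast] at h
  push_cast at h
  linarith [hcon.1, hcon.2]

end Summit.Parity.GeneralizedHardyLittlewood.GreenTaoLevelTwoGITwoQuadraticPhaseRung

end
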